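import Literature.NumberTheory.Automorphic.QuaternionAdeleAwaySplitting
import Literature.NumberTheory.Automorphic.QuaternionGLTwoAwayConjugacy
import Literature.MeasureTheory.Group.InvariantQuotientOrbitalTransport
import HarnessLib

/-!
# The orbital integrals away from `S` of matched elliptic classes of `Dˣ` and `GL₂` agree
(Gelbart, *Automorphic forms on adele groups* (1975), §10, pp. 153–155: in (10.14) and (10.15) the
factors `∫_{B_S \ G_S} f * f^*(x⁻¹ γ x) dx` and `∫_{B'_S \ G'_S} f * f^*(x⁻¹ γ x) dx` coincide once
`G'^S` is identified with `G^S`)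

Topic `NumberTheory/Automorphic`; one small definition with body (`GLn.toAwayGL`) and theorems; no
named fact, no instance visible to importers. In the comparison of the trace formulas for `G' = Dˣ` (10.14) and `G = GL₂` (10.15)
Gelbart (1975), p. 155, uses "`Z = Z'`, `G_S = G'_S`" (his `G_S`, `G'_S` are the groups AWAY from
the finite set `S ⊇ Ram(D)`; here `G^S = GLn.trivialAt 2 K S`, `G'^S = Quat.trivialAt K D S`) to
identify, for matched classes `{γ'} ↔ {γ}` (same reduced trace and norm), the orbital integrals of
`f * f^*` away from `S`. This file assembles that identification from

* `QuaternionAdeleAwaySplitting` — `Φ : G'^S ≃ₜ* G^S` compatible with a splitting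
  `Ψ : 𝔸^S ⊗ D ≃ₐ M₂(𝔸^S)` (`Quat.exists_trivialAt_continuousMulEquiv_trivialAt`);
* `QuaternionGLTwoAwayConjugacy` — `Ψ(1 ⊗ γ')` and `γ` are conjugate in `GL₂(𝔸^S)`
  (`Quat.exists_units_conj_algEquiv_incl_eq_map`);
* `InvariantQuotientOrbitalTransport` — orbital integrals along an isomorphism, up to conjugacy
  (`exists_integral_descConj_eq_smul_integral_descConj_comp_of_conj_eq`):

* `Quat.awayProj_localToAdelic_of_mem`, `Quat.units_map_awayProj_ofLocal_of_mem`,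
  `Quat.units_map_awayProj_toAdelicPi`, `Quat.units_map_awayProj_awayFromPlaces`,
  `Quat.awayProj_coe_inclAdelic` — reduction mod `e_S` kills `ι_S(D_Sˣ)`, so the part
  `s_S(x)` of `x` away from `S` and `x` have the same image in `(𝔸^S ⊗ D)ˣ`, and `1 ⊗ γ' ↦ 1 ⊗ γ'`;
  `GLn.toAwayGL` (reduction mod `e_S`, `GL_n(𝔸_K) →* GL_n(𝔸^S)`, the file's one small definition),
  `GLn.toAwayGL_toAdelic_of_mem`, `GLn.toAwayGL_toAdelicPi`, `GLn.toAwayGL_awayFromPlaces`,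
  `GLn.toAwayGL_gl_toAdelic`, `GLn.trivialAtEquivAwayGL_apply_eq` — the same on the `GL_n` side;
* `Quat.exists_conj_apply_awayFromPlaces_inclAdelic_eq` — **for matched `γ' ∈ Dˣ ∖ Kˣ`, `γ ∈ GL₂(K)`
  the away-from-`S` parts `Φ(s_S(γ'))` and `s_S(γ)` are conjugate in `G^S`** (for any compatible
  pair `(Ψ, Φ)`);
* `Quat.exists_integral_descConj_awayFromPlaces_eq_smul` — **the orbital integrals away from `S`
  agree**: for non-zero invariant measures `μ` on `G^S ⧸ C(s_S γ)` and `μ'` on `G'^S ⧸ C(s_S γ')` finite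
  on compact sets there is one `c ≠ 0` (the ratio of normalisations, independent of the integrand)
  with `∫_{G^S/C(s_Sγ)} Θ(y (s_Sγ) y⁻¹) dμ = c ∫_{G'^S/C(s_Sγ')} Θ(Φ(x (s_Sγ') x⁻¹)) dμ'` for every
  complex `Θ` on `G^S` — Gelbart's "`∫_{B_S \ G_S} f * f^*` is the same on both sides";
* `Quat.exists_continuousMulEquiv_forall_exists_conj` — existence of such a `Φ` for `S ⊇ Ram_f(D)`,
  `Ram_∞(D) = ∅` (from `QuaternionAdeleAwaySplitting`).

Not treated: the normalisation `c = 1` for Tamagawa measures, the factors at `S` ((10.20)–(10.21),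
local Jacquet–Langlands), the central terms. Part of the inline (D-0026) decomposition of
`Literature.NumberTheory.Automorphic.strong_multiplicity_one_quaternionUnits`.

## References

* S. Gelbart, *Automorphic forms on adele groups*, Ann. of Math. Studies 83 (1975), §10,
  pp. 153–155, (10.14), (10.15), (10.19) [Gelbart1975].
-/

noncomputable section

open MeasureTheory MeasureTheory.Measure NumberField IsDedekindDomain
open scoped NNReal ENNReal

universe u

namespace Literature.NumberTheory.Automorphic

open Literature.MeasureTheory.Group

/-! ### Reduction mod `e_S` on the `Dˣ` side -/

section MapLeft

variable (K : Type*) [Field K] (D : Type*) [Ring D] [Algebra K D]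

/-- `mapLeft f (1 ⊗ x) = 1 ⊗ x`. [folklore] -/
theorem ScalarExtension.mapLeft_incl {R T : Type*} [CommRing R] [Algebra K R] [CommRing T] [Algebra K T]
    (f : R →ₐ[K] T) (x : D) :
    ScalarExtension.mapLeft K D f (ScalarExtension.incl K R D x) = ScalarExtension.incl K T D x := by
  rw [ScalarExtension.incl_apply, ScalarExtension.mapLeft_tmul, map_one]
  rfl

end MapLeft

section QuatAway

variable (K : Type) [Field K] [NumberField K] (D : Type u) [Ring D] [Algebra K D]
  (S : Finset (HeightOneSpectrum (𝓞 K)))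

variable {K D S} in
/-- **Reduction mod `e_S` kills the factor `D_v`, `v ∈ S`**: `(mk ⊗ 1)(ι_v(z)) = 0`
(`ι_v(z) = E_v ι_v(z)` and `mk(e_v) = 0`). [folklore] -/
theorem Quat.awayProj_localToAdelic_of_mem {v : HeightOneSpectrum (𝓞 K)} (hv : v ∈ S)
    (z : ScalarExtension K (v.adicCompletion K) D) :
    Quat.awayProj K D S (Quat.localToAdelic K D v z) = 0 := by
  have h := Quat.algebraMap_adeleSingleHom_one_mul K D v (Quat.localToAdelic K D v z)
  rw [Quat.mapLeft_localToAdelic] at h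
  rw [← h, map_mul, Quat.awayProj, ScalarExtension.mapLeft_algebraMap]
  have h0 : AdeleAway.mk K S (adeleSingleHom K v 1) = 0 := by
    rw [← adelePlacesIdem_mul_adeleSingleHom_of_mem hv, AdeleAway.mk_adelePlacesIdem_mul]
  rw [h0, map_zero, zero_mul]

variable {K D S} in
/-- `(mk ⊗ 1)(ι_v(t)) = 1` in `(𝔸^S ⊗ D)ˣ` for `t ∈ D_vˣ`, `v ∈ S`. [folklore] -/
theorem Quat.units_map_awayProj_ofLocal_of_mem {v : HeightOneSpectrum (𝓞 K)} (hv : v ∈ S) (t : completionUnits D v) :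
    Units.map ((Quat.awayProj K D S).toRingHom : ScalarExtension K (AdeleRing (𝓞 K) K) D →*
      ScalarExtension K (AdeleAway K S) D) (Quat.ofLocal K D v t) = 1 := by
  refine Units.ext ?_
  rw [Units.coe_map, Quat.coe_ofLocal, Units.val_one]
  change Quat.awayProj K D S (1 + Quat.localToAdelic K D v ((t : ScalarExtension K (v.adicCompletion K) D) - 1)) = 1
  rw [map_add, map_one, Quat.awayProj_localToAdelic_of_mem hv, add_zero]

variable {K D S} in
/-- `(mk ⊗ 1)(ι_S(t)) = 1` for `t ∈ D_Sˣ`. [folklore] -/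
theorem Quat.units_map_awayProj_toAdelicPi (t : Quat.LocalPi K D S) :
    Units.map ((Quat.awayProj K D S).toRingHom : ScalarExtension K (AdeleRing (𝓞 K) K) D →*
      ScalarExtension K (AdeleAway K S) D) (Quat.toAdelicPi K D S t) = 1 := by
  classical
  rw [Quat.toAdelicPi_apply, Finset.map_noncommProd, Finset.noncommProd_eq_pow_card _ _ _ 1, one_pow]
  intro v _
  exact Quat.units_map_awayProj_ofLocal_of_mem v.2 (t v)

variable {K D S} in
/-- **`s_S(x)` and `x` have the same image in `(𝔸^S ⊗ D)ˣ`.** [folklore] -/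
theorem Quat.units_map_awayProj_awayFromPlaces (x : adelicUnits K D) :
    Units.map ((Quat.awayProj K D S).toRingHom : ScalarExtension K (AdeleRing (𝓞 K) K) D →*
      ScalarExtension K (AdeleAway K S) D) (Quat.awayFromPlaces K D S x) =
    Units.map ((Quat.awayProj K D S).toRingHom : ScalarExtension K (AdeleRing (𝓞 K) K) D →*
      ScalarExtension K (AdeleAway K S) D) x := by
  rw [Quat.awayFromPlaces, map_mul, map_inv, Quat.units_map_awayProj_toAdelicPi, inv_one, one_mul]

variable {K D S} in
/-- The same on underlying elements: `(mk ⊗ 1)(s_S x) = (mk ⊗ 1)(x)`. [folklore] -/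
theorem Quat.awayProj_coe_awayFromPlaces (x : adelicUnits K D) :
    Quat.awayProj K D S ((Quat.awayFromPlaces K D S x : adelicUnits K D) : ScalarExtension K (AdeleRing (𝓞 K) K) D) =
      Quat.awayProj K D S (x : ScalarExtension K (AdeleRing (𝓞 K) K) D) :=
  congrArg Units.val (Quat.units_map_awayProj_awayFromPlaces (S := S) x)

variable {K D S} in
/-- **The rational points reduce to the rational points**: `(mk ⊗ 1)(1 ⊗ γ') = 1 ⊗ γ'`. [folklore] -/
theorem Quat.awayProj_coe_inclAdelic (γ' : Dˣ) :
    Quat.awayProj K D S ((inclAdelic K D γ' : adelicUnits K D) : ScalarExtension K (AdeleRing (𝓞 K) K) D) =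
      ScalarExtension.incl K (AdeleAway K S) D γ' := by
  change Quat.awayProj K D S (ScalarExtension.incl K (AdeleRing (𝓞 K) K) D γ') = _
  exact ScalarExtension.mapLeft_incl K D (AdeleAway.mk K S) (γ' : D)

end QuatAway

/-! ### Reduction mod `e_S` on the `GL_n` side -/

section GLAway

variable (n : ℕ) (K : Type) [Field K] [NumberField K] (S : Finset (HeightOneSpectrum (𝓞 K)))

/-- **Reduction mod `e_S` on `GL_n(𝔸_K)`**: `GL_n(𝔸_K) →* GL_n(𝔸_K^S)`, entrywise `mk` on units
(`Units.map` of `GLn.awayProj`, with source the type `(AdelicGroupData.gl n K).Adelic` of the adelic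
datum so that products in that type are respected syntactically). [cite: Gelbart1975, §10 p. 153] -/
def GLn.toAwayGL : (AdelicGroupData.gl n K).Adelic →* GL (Fin n) (AdeleAway K S) :=
  Units.map (GLn.awayProj n K S).toMonoidHom

variable {n K S}

/-- Underlying matrix of `GLn.toAwayGL g`: the entrywise reduction of `g`. [folklore] -/
theorem GLn.coe_toAwayGL (g : (AdelicGroupData.gl n K).Adelic) :
    ((GLn.toAwayGL n K S g : GL (Fin n) (AdeleAway K S)) : Matrix (Fin n) (Fin n) (AdeleAway K S)) =
      GLn.awayProj n K S (Units.val (show GL (Fin n) (AdeleRing (𝓞 K) K) from g)) := rfl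

/-- `ι_v(a) mod e_S = 1` for `v ∈ S` (entries `δ_{ij} + ι_v(a_{ij} - δ_{ij})`, `mk ι_v = 0`). [folklore] -/
theorem GLn.toAwayGL_toAdelic_of_mem {v : HeightOneSpectrum (𝓞 K)} (hv : v ∈ S)
    (a : GL (Fin n) (v.adicCompletion K)) :
    GLn.toAwayGL n K S (GLn.toAdelic n K v a) = 1 := by
  refine Units.ext (Matrix.ext fun i j => ?_)
  rw [GLn.coe_toAwayGL, Units.val_one]
  change GLn.awayProj n K S (GLn.ofLocal n K v a : Matrix (Fin n) (Fin n) (AdeleRing (𝓞 K) K)) i j = _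
  rw [GLn.awayProj_apply, Matrix.map_apply, GLn.coe_ofLocal_apply, map_add,
    ← adelePlacesIdem_mul_adeleSingleHom_of_mem hv, AdeleAway.mk_adelePlacesIdem_mul, add_zero,
    Matrix.one_apply, Matrix.one_apply]
  split_ifs
  · exact map_one _
  · exact map_zero _

/-- `ι_S(t) mod e_S = 1`. [folklore] -/
theorem GLn.toAwayGL_toAdelicPi (t : GLn.LocalPi n K S) : GLn.toAwayGL n K S (GLn.toAdelicPi n K S t) = 1 := by
  classical
  rw [GLn.toAdelicPi_apply, Finset.map_noncommProd, Finset.noncommProd_eq_pow_card _ _ _ 1, one_pow]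
  intro v _
  exact GLn.toAwayGL_toAdelic_of_mem v.2 (t v)

/-- **`s_S(g)` and `g` have the same image in `GL_n(𝔸^S)`.** [folklore] -/
theorem GLn.toAwayGL_awayFromPlaces (g : (AdelicGroupData.gl n K).Adelic) :
    GLn.toAwayGL n K S (GLn.awayFromPlaces n K S g) = GLn.toAwayGL n K S g := by
  rw [GLn.awayFromPlaces, map_mul, map_inv, GLn.toAwayGL_toAdelicPi, inv_one, mul_one]

/-- **The rational points reduce to the rational points**: `γ mod e_S = γ` for `γ ∈ GL_n(K)`
(entries `mk(c) = c` for `c ∈ K`). [folklore] -/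
theorem GLn.toAwayGL_gl_toAdelic (γ : GL (Fin n) K) :
    GLn.toAwayGL n K S ((AdelicGroupData.gl n K).toAdelic γ) =
      Matrix.GeneralLinearGroup.map (algebraMap K (AdeleAway K S)) γ :=
  Units.ext (Matrix.ext fun _ _ => rfl)

/-- `GLn.trivialAtEquivAwayGL` is reduction mod `e_S` restricted to `G^S`. [folklore] -/
theorem GLn.trivialAtEquivAwayGL_apply_eq (g : GLn.trivialAt n K S) :
    GLn.trivialAtEquivAwayGL n K S g = GLn.toAwayGL n K S (g : (AdelicGroupData.gl n K).Adelic) :=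
  Units.ext rfl

end GLAway

/-! ### Matched elliptic classes: the away-from-`S` parts are conjugate in `G^S` -/

section Conj

variable (K : Type) [Field K] [NumberField K] (D : Type u) [Ring D] [Algebra K D] [IsQuaternionAlgebra K D]
  (S : Finset (HeightOneSpectrum (𝓞 K)))

/-- **For matched `γ' ∈ Dˣ ∖ Kˣ` and `γ ∈ GL₂(K)` the away-from-`S` parts `Φ(s_S γ')` and `s_S γ` are
conjugate in `G^S`.** Here `D` is a division quaternion algebra, `(Ψ, Φ)` is any compatible pair of a
splitting `Ψ : 𝔸^S ⊗ D ≃ₐ[𝔸^S] M₂(𝔸^S)` and an isomorphism `Φ : G'^S ≃ₜ* G^S` (`Φ(x) mod e_S = Ψ((mk ⊗ 1) x)`,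
as produced by `Quat.exists_trivialAt_continuousMulEquiv_trivialAt`), `tr γ = trd γ'`, `det γ = nrd γ'`;
`s_S` are the "part away from `S`" of the splittings `Quat.placesSplitting` / `GLn.placesSplitting`
applied to the diagonal images of `γ'`, `γ`. (Read in `GL₂(𝔸^S)`: `Φ(s_S γ') ↦ Ψ(1 ⊗ γ')`, `s_S γ ↦ γ`,
conjugate by `Quat.exists_units_conj_algEquiv_incl_eq_map`.) [cite: Gelbart1975, §10 pp. 154–155] -/
theorem Quat.exists_conj_apply_awayFromPlaces_inclAdelic_eq (hD : ∀ x : D, x ≠ 0 → IsUnit x)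
    (Ψ : ScalarExtension K (AdeleAway K S) D ≃ₐ[AdeleAway K S] Matrix (Fin 2) (Fin 2) (AdeleAway K S))
    (Φ : Quat.trivialAt K D S ≃ₜ* GLn.trivialAt 2 K S)
    (hΦ : ∀ x : Quat.trivialAt K D S,
      (Units.val (show GL (Fin 2) (AdeleRing (𝓞 K) K) from ((Φ x : GLn.trivialAt 2 K S) : (AdelicGroupData.gl 2 K).Adelic))).map
          (AdeleAway.mk K S) =
        Ψ (Quat.awayProj K D S ((x : adelicUnits K D) : ScalarExtension K (AdeleRing (𝓞 K) K) D)))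
    {γ' : Dˣ} (hγ' : (γ' : D) ∉ (⊥ : Subalgebra K D)) (γ : GL (Fin 2) K)
    (ht : (γ : Matrix (Fin 2) (Fin 2) K).trace = reducedTrace K D γ')
    (hd : (γ : Matrix (Fin 2) (Fin 2) K).det = reducedNorm K D γ') :
    ∃ q : GLn.trivialAt 2 K S,
      q * Φ ((Quat.placesSplitting K D S).symm (inclAdelic K D γ')).2 * q⁻¹ =
        ((GLn.placesSplitting 2 K S).symm ((AdelicGroupData.gl 2 K).toAdelic γ)).2 := by
  haveI : Module.Finite K D := inferInstance
  obtain ⟨Q, hQ⟩ := Quat.exists_units_conj_algEquiv_incl_eq_map K D S hD Ψ hγ' (γ : Matrix (Fin 2) (Fin 2) K) ht hd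
  set E := GLn.trivialAtEquivAwayGL 2 K S with hE
  set δ' : Quat.trivialAt K D S := ((Quat.placesSplitting K D S).symm (inclAdelic K D γ')).2 with hδ'
  set δ : GLn.trivialAt 2 K S := ((GLn.placesSplitting 2 K S).symm ((AdelicGroupData.gl 2 K).toAdelic γ)).2 with hδ
  -- the images in `GL₂(𝔸^S)`
  have h1 : ((E (Φ δ') : GL (Fin 2) (AdeleAway K S)) : Matrix (Fin 2) (Fin 2) (AdeleAway K S)) =
      Ψ (ScalarExtension.incl K (AdeleAway K S) D γ') := by
    rw [hE, GLn.coe_trivialAtEquivAwayGL, hΦ δ', hδ', Quat.placesSplitting_symm_apply_snd,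
      Quat.awayProj_coe_awayFromPlaces, Quat.awayProj_coe_inclAdelic]
  have h2 : E δ = Matrix.GeneralLinearGroup.map (algebraMap K (AdeleAway K S)) γ := by
    rw [GLn.trivialAtEquivAwayGL_apply_eq, hδ, GLn.placesSplitting_symm_apply_snd,
      GLn.toAwayGL_awayFromPlaces, GLn.toAwayGL_gl_toAdelic]
  have h3 : Q * E (Φ δ') * Q⁻¹ = E δ := by
    refine Units.ext ?_
    rw [Units.val_mul, Units.val_mul, h1, h2]
    exact hQ
  refine ⟨E.symm Q, E.injective ?_⟩
  rw [map_mul, map_mul, map_inv, ContinuousMulEquiv.apply_symm_apply]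
  exact h3

/-- **Existence of the identification**: for `S ⊇ Ram_f(D)` and `D` unramified at infinity there is
an isomorphism of topological groups `Φ : G'^S ≃ₜ* G^S` carrying, for every matched pair
`γ' ∈ Dˣ ∖ Kˣ`, `γ ∈ GL₂(K)`, the away-from-`S` part of `γ'` to a conjugate of the away-from-`S` part
of `γ`. [cite: Gelbart1975, §10 pp. 153–155, Remark 10.7 (i)] -/
theorem Quat.exists_continuousMulEquiv_forall_exists_conj (hD : ∀ x : D, x ≠ 0 → IsUnit x)
    (hS : ramifiedPlaces K D ⊆ (S : Set (HeightOneSpectrum (𝓞 K)))) (hi : ramifiedInfinitePlaces K D = ∅) :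
    ∃ Φ : Quat.trivialAt K D S ≃ₜ* GLn.trivialAt 2 K S,
      ∀ (γ' : Dˣ), (γ' : D) ∉ (⊥ : Subalgebra K D) → ∀ γ : GL (Fin 2) K,
        (γ : Matrix (Fin 2) (Fin 2) K).trace = reducedTrace K D γ' →
        (γ : Matrix (Fin 2) (Fin 2) K).det = reducedNorm K D γ' →
          ∃ q : GLn.trivialAt 2 K S,
            q * Φ ((Quat.placesSplitting K D S).symm (inclAdelic K D γ')).2 * q⁻¹ =
              ((GLn.placesSplitting 2 K S).symm ((AdelicGroupData.gl 2 K).toAdelic γ)).2 := by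
  obtain ⟨Ψ, Φ, hΦ⟩ := Quat.exists_trivialAt_continuousMulEquiv_trivialAt K D S hS hi
  exact ⟨Φ, fun γ' hγ' γ ht hd => Quat.exists_conj_apply_awayFromPlaces_inclAdelic_eq K D S hD Ψ Φ hΦ hγ' γ ht hd⟩

end Conj

/-! ### The orbital integrals away from `S` agree -/

section Orbital

variable (K : Type) [Field K] [NumberField K] (D : Type u) [Ring D] [Algebra K D] [IsQuaternionAlgebra K D]
  (S : Finset (HeightOneSpectrum (𝓞 K)))

attribute [local instance] adelicBorel borelSpace_adelic locallyCompactSpace_adelic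
  secondCountableTopology_gl_adelic

/-- **The orbital integrals away from `S` of matched elliptic classes agree up to the normalisation
of the invariant measures** (Gelbart (1975), p. 155: in comparing (10.14) with (10.15) the factors
`∫_{B_S \ G_S} f * f^*(x⁻¹ γ x) dx` away from `S` are the same since "`G_S = G'_S`"). For a division
quaternion algebra `D`, a compatible pair `(Ψ, Φ)` as in `Quat.exists_trivialAt_continuousMulEquiv_trivialAt`,
matched `γ' ∈ Dˣ ∖ Kˣ` and `γ ∈ GL₂(K)`, their away-from-`S` parts `δ' = s_S(γ') ∈ G'^S`, `δ = s_S(γ) ∈ G^S`,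
and non-zero invariant measures `μ` on `G^S ⧸ C(δ)`, `μ'` on `G'^S ⧸ C(δ')` finite on compact sets, there
is ONE `c ≠ 0` with `∫_{G^S/C(δ)} Θ(y δ y⁻¹) dμ(y) = c ∫_{G'^S/C(δ')} Θ(Φ(x δ' x⁻¹)) dμ'(x)` for every complex
`Θ` on `G^S` (the test function `f * f^*` of (10.14) being `Θ ∘ Φ` when that of (10.15) is `Θ`).
[cite: Gelbart1975, §10 pp. 154–155 (10.14), (10.15)] -/
theorem Quat.exists_integral_descConj_awayFromPlaces_eq_smul (hD : ∀ x : D, x ≠ 0 → IsUnit x)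
    (Ψ : ScalarExtension K (AdeleAway K S) D ≃ₐ[AdeleAway K S] Matrix (Fin 2) (Fin 2) (AdeleAway K S))
    (Φ : Quat.trivialAt K D S ≃ₜ* GLn.trivialAt 2 K S)
    (hΦ : ∀ x : Quat.trivialAt K D S,
      (Units.val (show GL (Fin 2) (AdeleRing (𝓞 K) K) from ((Φ x : GLn.trivialAt 2 K S) : (AdelicGroupData.gl 2 K).Adelic))).map
          (AdeleAway.mk K S) =
        Ψ (Quat.awayProj K D S ((x : adelicUnits K D) : ScalarExtension K (AdeleRing (𝓞 K) K) D)))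
    {γ' : Dˣ} (hγ' : (γ' : D) ∉ (⊥ : Subalgebra K D)) (γ : GL (Fin 2) K)
    (ht : (γ : Matrix (Fin 2) (Fin 2) K).trace = reducedTrace K D γ')
    (hd : (γ : Matrix (Fin 2) (Fin 2) K).det = reducedNorm K D γ')
    [MeasurableSpace (Quat.trivialAt K D S ⧸ Subgroup.centralizer
      ({((Quat.placesSplitting K D S).symm (inclAdelic K D γ')).2} : Set (Quat.trivialAt K D S)))]
    [BorelSpace (Quat.trivialAt K D S ⧸ Subgroup.centralizer
      ({((Quat.placesSplitting K D S).symm (inclAdelic K D γ')).2} : Set (Quat.trivialAt K D S)))]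
    [MeasurableSpace (GLn.trivialAt 2 K S ⧸ Subgroup.centralizer
      ({((GLn.placesSplitting 2 K S).symm ((AdelicGroupData.gl 2 K).toAdelic γ)).2} : Set (GLn.trivialAt 2 K S)))]
    [BorelSpace (GLn.trivialAt 2 K S ⧸ Subgroup.centralizer
      ({((GLn.placesSplitting 2 K S).symm ((AdelicGroupData.gl 2 K).toAdelic γ)).2} : Set (GLn.trivialAt 2 K S)))]
    (μ' : Measure (Quat.trivialAt K D S ⧸ Subgroup.centralizer
      ({((Quat.placesSplitting K D S).symm (inclAdelic K D γ')).2} : Set (Quat.trivialAt K D S))))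
    [SMulInvariantMeasure (Quat.trivialAt K D S) _ μ'] [IsFiniteMeasureOnCompacts μ']
    (μ : Measure (GLn.trivialAt 2 K S ⧸ Subgroup.centralizer
      ({((GLn.placesSplitting 2 K S).symm ((AdelicGroupData.gl 2 K).toAdelic γ)).2} : Set (GLn.trivialAt 2 K S))))
    [SMulInvariantMeasure (GLn.trivialAt 2 K S) _ μ] [IsFiniteMeasureOnCompacts μ]
    (hμ' : μ' ≠ 0) (hμ : μ ≠ 0) :
    ∃ c : ℝ≥0, c ≠ 0 ∧ ∀ Θ : GLn.trivialAt 2 K S → ℂ,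
      ∫ y, descConj ((GLn.placesSplitting 2 K S).symm ((AdelicGroupData.gl 2 K).toAdelic γ)).2 _
          (Literature.MeasureTheory.Group.centralizer_comm _) Θ y ∂μ =
        c • ∫ x, descConj ((Quat.placesSplitting K D S).symm (inclAdelic K D γ')).2 _
          (Literature.MeasureTheory.Group.centralizer_comm _) (Θ ∘ Φ) x ∂μ' := by
  haveI : T2Space (AdelicGroupData.gl 2 K).Adelic := t2Space_gl 2 K
  haveI : ∀ v : HeightOneSpectrum (𝓞 K), T2Space (GL (Fin 2) (v.adicCompletion K)) := fun v =>
    T2Space.of_injective_continuous (f := GLn.toAdelic 2 K v) (GLn.toAdelic_injective) (GLn.continuous_toAdelic 2 K v)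
  haveI : SecondCountableTopology (GLn.trivialAt 2 K S) := TopologicalSpace.Subtype.secondCountableTopology _
  haveI : LocallyCompactSpace (GLn.trivialAt 2 K S) :=
    (GLn.isClosed_trivialAt 2 K S).isClosedEmbedding_subtypeVal.locallyCompactSpace
  obtain ⟨q, hq⟩ := Quat.exists_conj_apply_awayFromPlaces_inclAdelic_eq K D S hD Ψ Φ hΦ hγ' γ ht hd
  exact exists_integral_descConj_eq_smul_integral_descConj_comp_of_conj_eq Φ.toMulEquiv Φ.continuous
    Φ.symm.continuous q hq μ' μ hμ' hμ

end Orbital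

end Literature.NumberTheory.Automorphic
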